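import Summits.AtomisticToContinuum.Crystallization.Theorems.SquareWellLayerCakeGapTwelveToBarlowCombinatorialLayeringTransportFiniteStack
import Summits.AtomisticToContinuum.Crystallization.Theorems.SquareWellLayerCakeGapTwelveToBarlowCombinatorialLayeringTransportGlobalE
import Summits.AtomisticToContinuum.Crystallization.Theorems.SquareWellLayerCakeGapTwelveToBarlowCombinatorialLayeringTransportGlobalD
import Summits.AtomisticToContinuum.Crystallization.Theorems.PalmUnimodularRigidityShellsToBarlowChartTransportGlobalF
import Summits.AtomisticToContinuum.Crystallization.Theorems.PalmUnimodularRigidityShellsToBarlowChartTransportGlobalE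
import Summits.AtomisticToContinuum.Crystallization.Theorems.PalmUnimodularRigidityShellsToBarlowChartTransportGlobalD
import Summits.AtomisticToContinuum.Crystallization.Theorems.PalmUnimodularRigidityShellsToBarlowChartTransportGlobalC
import Summits.AtomisticToContinuum.Crystallization.Theorems.PalmUnimodularRigidityShellsToBarlowChartTransportGlobalA
import Summits.AtomisticToContinuum.Crystallization.Theorems.PalmUnimodularRigidityShellsToBarlowChartTransportGlobalB

/-!
# Combinatorial layering (B1a of `GapTwelveToBarlow`): STAR and LINK at every frame of the finite development

Crux `SquareWellLayerCake.GapTwelveToBarlow` (stmt-AtomisticToContinuum-15807), line `Sketch`,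
stub `stub_combinatorialLayering`, residual `(H_develop)`; fifth piece of the FINITE DEVELOPMENT:
the graded analogues of 9227's `sites`, `par_IJ`, `star_at` (`…TransportGlobalF`).  For the
development `frameAt g₀ k i j` of `…TransportFiniteStack` (base frame at level `n + K + 4 + R`,
`3K ≤ R`) and a frame `(k, i, j)` with `|k| + 1 ≤ K` and `|j| + |i| + 3(|k| + 1) + 4 ≤ R` (so that
its layer and the two adjacent layers contain all the sites involved): the twelve neighbour sites by
label (`sitesFin`), parity constant along `I`, `J` (`par_IJFin`), and STAR ∧ LINK — the twelve
model neighbours `(k, i, j) + linkOffsets σm σp` are mapped by the development bijectively onto the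
`B`-neighbours of the site, and bonds among them are read by `linkAdj` (`star_atFin`; the landed
`star_core` and the four letter tables of `…TransportGlobalD`).  The plane of layer `k'` is packaged
by `planeAtFin` in the hypothesis format of `…TransportGlobalE`.  All `[folklore]`.
-/

noncomputable section

namespace Summit.AtomisticToContinuum.Crystallization.Theorems.SquareWellLayerCakeGapTwelveToBarlow

open Literature.Geometry.DiscreteGeometry Literature.MathematicalPhysics.StatisticalMechanics
open Summit.AtomisticToContinuum.Crystallization.Theorems.PalmUnimodularRigidityShellsToBarlowChart hiding
  IsZChart TransportSystem scales_tied sqNormInt_transfer bond_symm nb_mem zlab_spec zlab_nb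
  bond_nb_iff pattern_cases transfer_nb_nb transfer_nb_centre transfer_nb_target
  sqNormInt_zlab_centre hcp_of_mirror_pair Istep_spec Jstep_spec IinvStep_spec JinvStep_spec
  capWithAny_of_mem_cap IinvStep_Istep Istep_IinvStep JinvStep_Jstep Jstep_JinvStep polar_at_apex
  onesided_at_apex Vstep_spec nb_inj Istep_lower Jstep_lower IinvStep_lower JinvStep_lower
  polar_at_lower_apex onesided_at_lower_apex VinvStep_spec attach_I_even attach_I_odd
  attach_lower_I_pos attach_lower_I_neg attach_J_even attach_J_odd Vstep_Istep_pt Vstep_Istep_back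
  Vstep_Istep_side Vstep_Jstep_pt Vstep_Istep_comm Vstep_Jstep_comm attach_lower_J_pos
  attach_lower_J_neg VinvStep_Istep_pt VinvStep_Jstep_pt VinvStep_Istep_back VinvStep_Istep_side
  VinvStep_Istep_comm VinvStep_Jstep_comm Istep_Jstep_comm sites par_IJ lowerParity_eq_par_below
  star_at sites_inlayer up_of_V up_of_Vinv down_of_Vinv down_of_V star_core table_fcc_p table_fcc_m
  table_hcp_p table_hcp_m layers back_I back_J nbhd layer_up layer_down line_I line_J
  adm_transports layer_zero

variable {S : ℕ → Set (EuclideanSpace ℝ (Fin 3))}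
  {B : EuclideanSpace ℝ (Fin 3) → EuclideanSpace ℝ (Fin 3) → Prop}
  {Pc : EuclideanSpace ℝ (Fin 3) → Finset (Fin 3 → ℤ)}
  {nb : EuclideanSpace ℝ (Fin 3) → (Fin 3 → ℤ) → EuclideanSpace ℝ (Fin 3)}

variable
  (hch : (∀ n : ℕ, ∀ z ∈ S n, (Pc z = fcc3Int ∨ Pc z = hcpInt) ∧
      Set.BijOn (nb z) (↑(Pc z) : Set (Fin 3 → ℤ)) {y | B z y} ∧
      ∀ t ∈ Pc z, ∀ t' ∈ Pc z, (B (nb z t) (nb z t') ↔ sqNormInt (t - t') = 18)) ∧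
    (∀ n : ℕ, ∀ z ∈ S (n + 1), ∀ y, B z y → y ∈ S n) ∧
    (∀ n m : ℕ, ∀ x ∈ S n, ∀ y ∈ S m, B x y →
      ∀ (z z' : EuclideanSpace ℝ (Fin 3)) (t t' u u' : Fin 3 → ℤ),
        (t = 0 ∧ z = x ∨ t ∈ Pc x ∧ z = nb x t) → (t' = 0 ∧ z' = x ∨ t' ∈ Pc x ∧ z' = nb x t') →
        (u = 0 ∧ z = y ∨ u ∈ Pc y ∧ z = nb y u) → (u' = 0 ∧ z' = y ∨ u' ∈ Pc y ∧ z' = nb y u') →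
        sqNormInt (u - u') = sqNormInt (t - t')) ∧
    (∀ x y, B x y → B y x))

include hch


/-- The plane of layer `k'`, `|k'| ≤ K`, in the hypothesis format of `…TransportGlobalE` (radius
`R − 3|k'|`, levels `n + (K − |k'|) + (R − |j| − |i|) + 4`). [folklore] -/
theorem planeAtFin {n K R : ℕ} {g₀ : ZFrame} (h₀ : IsFrame (Pc g₀.pt) g₀.t₁ g₀.t₂ g₀.U)
    (h₀S : g₀.pt ∈ S (n + K + 4 + R)) (h₀p : frameParity g₀.t₁ g₀.t₂ g₀.U = 1)
    (h₀A : (∀ m, ∀ z ∈ S m, Pc z = fcc3Int) ∨ Pc g₀.pt = hcpInt) (hKR : 3 * K ≤ R) (k' : ℤ) (hk' : k'.natAbs ≤ K) :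
    (∀ i j : ℤ, j.natAbs + i.natAbs ≤ R - 3 * k'.natAbs →
      IsFrame (Pc (frameAt Pc nb g₀ k' i j).pt) (frameAt Pc nb g₀ k' i j).t₁ (frameAt Pc nb g₀ k' i j).t₂ (frameAt Pc nb g₀ k' i j).U) ∧
    (∀ i j : ℤ, j.natAbs + i.natAbs ≤ R - 3 * k'.natAbs →
      (frameAt Pc nb g₀ k' i j).pt ∈ S ((fun i j : ℤ => n + (K - k'.natAbs) + (R - j.natAbs - i.natAbs)) i j + 4)) ∧
    (∀ i j : ℤ, j.natAbs + i.natAbs + 1 ≤ R - 3 * k'.natAbs → frameAt Pc nb g₀ k' (i + 1) j = Istep Pc nb (frameAt Pc nb g₀ k' i j)) ∧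
    (∀ i j : ℤ, j.natAbs + 1 + i.natAbs ≤ R - 3 * k'.natAbs → frameAt Pc nb g₀ k' i (j + 1) = Jstep Pc nb (frameAt Pc nb g₀ k' i j)) := by
  obtain ⟨hv, hIc, hJc⟩ := layersFin_int hch h₀ h₀S h₀p h₀A hKR k' hk'
  exact ⟨fun i j h => (hv i j (by omega)).1, fun i j h => (hv i j (by omega)).2,
    fun i j h => hIc i j (by omega), fun i j h => hJc i j (by omega)⟩

/-- **The twelve neighbour sites of a frame of the finite development, by label** (graded
`sites`).  For
`⟨x, t₁, t₂, U⟩ = frameAt g₀ k i j` with apexes `c` (upper cap) and `d` (lower cap): the sites at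
`(k, i±1, j)`, `(k, i, j±1)`, `(k, i∓1, j±1)`, `(k+1, ·)`, `(k−1, ·)` carry the expected labels.
[folklore] -/
theorem sitesFin {n K R : ℕ} {g₀ : ZFrame} (h₀ : IsFrame (Pc g₀.pt) g₀.t₁ g₀.t₂ g₀.U)
    (h₀S : g₀.pt ∈ S (n + K + 4 + R)) (h₀p : frameParity g₀.t₁ g₀.t₂ g₀.U = 1)
    (h₀A : (∀ m, ∀ z ∈ S m, Pc z = fcc3Int) ∨ Pc g₀.pt = hcpInt) (hKR : 3 * K ≤ R)
    (k i j : ℤ) (hk : k.natAbs + 1 ≤ K) (hij : j.natAbs + i.natAbs + 3 * (k.natAbs + 1) + 4 ≤ R) {x : (EuclideanSpace ℝ (Fin 3))} {t₁ t₂ : Fin 3 → ℤ}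
    {U : Finset (Fin 3 → ℤ)} (h : frameAt Pc nb g₀ k i j = ⟨x, t₁, t₂, U⟩) :
    (frameAt Pc nb g₀ k (i + 1) j).pt = nb x t₁ ∧ (frameAt Pc nb g₀ k (i - 1) j).pt = nb x (-t₁) ∧
    (frameAt Pc nb g₀ k i (j + 1)).pt = nb x t₂ ∧ (frameAt Pc nb g₀ k i (j - 1)).pt = nb x (-t₂) ∧
    (frameAt Pc nb g₀ k (i - 1) (j + 1)).pt = nb x (t₂ - t₁) ∧
    (frameAt Pc nb g₀ k (i + 1) (j - 1)).pt = nb x (t₁ - t₂) ∧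
    (frameAt Pc nb g₀ (k + 1) i j).pt = nb x (apexOf t₁ t₂ U) ∧
    (frameParity t₁ t₂ U = 1 → (frameAt Pc nb g₀ (k + 1) (i - 1) j).pt = nb x (apexOf t₁ t₂ U - t₁) ∧
      (frameAt Pc nb g₀ (k + 1) i (j - 1)).pt = nb x (apexOf t₁ t₂ U - t₂)) ∧
    (frameParity t₁ t₂ U = -1 → (frameAt Pc nb g₀ (k + 1) (i + 1) j).pt = nb x (apexOf t₁ t₂ U + t₁) ∧
      (frameAt Pc nb g₀ (k + 1) i (j + 1)).pt = nb x (apexOf t₁ t₂ U + t₂)) ∧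
    (frameAt Pc nb g₀ (k - 1) i j).pt = nb x (apexOf t₁ t₂ (lowerCap (Pc x) t₁ t₂ U)) ∧
    (lowerParity t₁ t₂ (lowerCap (Pc x) t₁ t₂ U) = 1 →
      (frameAt Pc nb g₀ (k - 1) (i + 1) j).pt = nb x (apexOf t₁ t₂ (lowerCap (Pc x) t₁ t₂ U) + t₁) ∧
      (frameAt Pc nb g₀ (k - 1) i (j + 1)).pt = nb x (apexOf t₁ t₂ (lowerCap (Pc x) t₁ t₂ U) + t₂)) ∧
    (lowerParity t₁ t₂ (lowerCap (Pc x) t₁ t₂ U) = -1 →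
      (frameAt Pc nb g₀ (k - 1) (i - 1) j).pt = nb x (apexOf t₁ t₂ (lowerCap (Pc x) t₁ t₂ U) - t₁) ∧
      (frameAt Pc nb g₀ (k - 1) i (j - 1)).pt = nb x (apexOf t₁ t₂ (lowerCap (Pc x) t₁ t₂ U) - t₂)) := by
  obtain ⟨e1, e2, e3, e4, e5, e6⟩ := sites_inlayerFin hch (R := R - 3 * (k).natAbs) (L := fun i j : ℤ => n + (K - (k).natAbs) + (R - j.natAbs - i.natAbs)) (planeAtFin hch h₀ h₀S h₀p h₀A hKR (k) (by omega)).1 (planeAtFin hch h₀ h₀S h₀p h₀A hKR (k) (by omega)).2.1 (planeAtFin hch h₀ h₀S h₀p h₀A hKR (k) (by omega)).2.2.1 (planeAtFin hch h₀ h₀S h₀p h₀A hKR (k) (by omega)).2.2.2 i j (by omega) h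
  refine ⟨e1, e2, e3, e4, e5, e6, ?_⟩
  -- upper part
  have hup : (frameAt Pc nb g₀ (k + 1) i j).pt = nb x (apexOf t₁ t₂ U) ∧
      (frameParity t₁ t₂ U = 1 → (frameAt Pc nb g₀ (k + 1) (i - 1) j).pt = nb x (apexOf t₁ t₂ U - t₁) ∧
        (frameAt Pc nb g₀ (k + 1) i (j - 1)).pt = nb x (apexOf t₁ t₂ U - t₂)) ∧
      (frameParity t₁ t₂ U = -1 → (frameAt Pc nb g₀ (k + 1) (i + 1) j).pt = nb x (apexOf t₁ t₂ U + t₁) ∧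
        (frameAt Pc nb g₀ (k + 1) i (j + 1)).pt = nb x (apexOf t₁ t₂ U + t₂)) := by
    rcases int_cases k with ⟨n', rfl⟩ | ⟨m, rfl⟩
    · have E := up_of_VFin hch (R := R - 3 * (n' : ℤ).natAbs) (L := fun i j : ℤ => n + (K - (n' : ℤ).natAbs) + (R - j.natAbs - i.natAbs)) (planeAtFin hch h₀ h₀S h₀p h₀A hKR ((n' : ℤ)) (by omega)).1 (planeAtFin hch h₀ h₀S h₀p h₀A hKR ((n' : ℤ)) (by omega)).2.1 (planeAtFin hch h₀ h₀S h₀p h₀A hKR ((n' : ℤ)) (by omega)).2.2.1 (planeAtFin hch h₀ h₀S h₀p h₀A hKR ((n' : ℤ)) (by omega)).2.2.2 i j (by omega) h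
      simp only [frameAt_natSucc]
      exact E
    · have h' : VinvStep Pc nb (frameAt Pc nb g₀ (-(m : ℤ)) i j) = ⟨x, t₁, t₂, U⟩ := by
        rw [← frameAt_negSucc]; exact h
      have E := up_of_VinvFin hch (R := R - 3 * (-(m : ℤ)).natAbs) (L := fun i j : ℤ => n + (K - (-(m : ℤ)).natAbs) + (R - j.natAbs - i.natAbs)) (planeAtFin hch h₀ h₀S h₀p h₀A hKR ((-(m : ℤ))) (by omega)).1 (planeAtFin hch h₀ h₀S h₀p h₀A hKR ((-(m : ℤ))) (by omega)).2.1 (planeAtFin hch h₀ h₀S h₀p h₀A hKR ((-(m : ℤ))) (by omega)).2.2.1 (planeAtFin hch h₀ h₀S h₀p h₀A hKR ((-(m : ℤ))) (by omega)).2.2.2 i j (by omega) h'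
      rw [show -((m : ℤ) + 1) + 1 = -(m : ℤ) by ring]
      exact E
  -- lower part
  have hdn : (frameAt Pc nb g₀ (k - 1) i j).pt = nb x (apexOf t₁ t₂ (lowerCap (Pc x) t₁ t₂ U)) ∧
      (lowerParity t₁ t₂ (lowerCap (Pc x) t₁ t₂ U) = 1 →
        (frameAt Pc nb g₀ (k - 1) (i + 1) j).pt = nb x (apexOf t₁ t₂ (lowerCap (Pc x) t₁ t₂ U) + t₁) ∧
        (frameAt Pc nb g₀ (k - 1) i (j + 1)).pt = nb x (apexOf t₁ t₂ (lowerCap (Pc x) t₁ t₂ U) + t₂)) ∧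
      (lowerParity t₁ t₂ (lowerCap (Pc x) t₁ t₂ U) = -1 →
        (frameAt Pc nb g₀ (k - 1) (i - 1) j).pt = nb x (apexOf t₁ t₂ (lowerCap (Pc x) t₁ t₂ U) - t₁) ∧
        (frameAt Pc nb g₀ (k - 1) i (j - 1)).pt = nb x (apexOf t₁ t₂ (lowerCap (Pc x) t₁ t₂ U) - t₂)) := by
    rcases int_cases' k with ⟨n', rfl⟩ | ⟨m, rfl⟩
    · have h' : Vstep Pc nb (frameAt Pc nb g₀ (n' : ℤ) i j) = ⟨x, t₁, t₂, U⟩ := by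
        rw [← frameAt_natSucc]; exact h
      have E := down_of_VFin hch (R := R - 3 * (n' : ℤ).natAbs) (L := fun i j : ℤ => n + (K - (n' : ℤ).natAbs) + (R - j.natAbs - i.natAbs)) (planeAtFin hch h₀ h₀S h₀p h₀A hKR ((n' : ℤ)) (by omega)).1 (planeAtFin hch h₀ h₀S h₀p h₀A hKR ((n' : ℤ)) (by omega)).2.1 (planeAtFin hch h₀ h₀S h₀p h₀A hKR ((n' : ℤ)) (by omega)).2.2.1 (planeAtFin hch h₀ h₀S h₀p h₀A hKR ((n' : ℤ)) (by omega)).2.2.2 i j (by omega) h'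
      rw [show (n' : ℤ) + 1 - 1 = (n' : ℤ) by ring]
      exact E
    · have E := down_of_VinvFin hch (R := R - 3 * (-(m : ℤ)).natAbs) (L := fun i j : ℤ => n + (K - (-(m : ℤ)).natAbs) + (R - j.natAbs - i.natAbs)) (planeAtFin hch h₀ h₀S h₀p h₀A hKR ((-(m : ℤ))) (by omega)).1 (planeAtFin hch h₀ h₀S h₀p h₀A hKR ((-(m : ℤ))) (by omega)).2.1 (planeAtFin hch h₀ h₀S h₀p h₀A hKR ((-(m : ℤ))) (by omega)).2.2.1 (planeAtFin hch h₀ h₀S h₀p h₀A hKR ((-(m : ℤ))) (by omega)).2.2.2 i j (by omega) h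
      rw [show -(m : ℤ) - 1 = -((m : ℤ) + 1) by ring]
      simp only [frameAt_negSucc]
      exact E
  exact ⟨hup.1, hup.2.1, hup.2.2, hdn.1, hdn.2.1, hdn.2.2⟩

/-- Parity is constant along `I` and `J` in the finite development (graded `par_IJ`). [folklore] -/
theorem par_IJFin {n K R : ℕ} {g₀ : ZFrame} (h₀ : IsFrame (Pc g₀.pt) g₀.t₁ g₀.t₂ g₀.U)
    (h₀S : g₀.pt ∈ S (n + K + 4 + R)) (h₀p : frameParity g₀.t₁ g₀.t₂ g₀.U = 1)
    (h₀A : (∀ m, ∀ z ∈ S m, Pc z = fcc3Int) ∨ Pc g₀.pt = hcpInt) (hKR : 3 * K ≤ R)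
    (k i j : ℤ) (hk : k.natAbs ≤ K) (hij : j.natAbs + i.natAbs + 3 * k.natAbs + 4 ≤ R) :
    frameParity (frameAt Pc nb g₀ k (i + 1) j).t₁ (frameAt Pc nb g₀ k (i + 1) j).t₂ (frameAt Pc nb g₀ k (i + 1) j).U =
      frameParity (frameAt Pc nb g₀ k i j).t₁ (frameAt Pc nb g₀ k i j).t₂ (frameAt Pc nb g₀ k i j).U ∧
    frameParity (frameAt Pc nb g₀ k i (j + 1)).t₁ (frameAt Pc nb g₀ k i (j + 1)).t₂ (frameAt Pc nb g₀ k i (j + 1)).U =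
      frameParity (frameAt Pc nb g₀ k i j).t₁ (frameAt Pc nb g₀ k i j).t₂ (frameAt Pc nb g₀ k i j).U := by
  obtain ⟨hvalk, hSk, hIk, hJk⟩ := planeAtFin hch h₀ h₀S h₀p h₀A hKR k hk
  rcases h : frameAt Pc nb g₀ k i j with ⟨x, t₁, t₂, U⟩
  obtain ⟨hx, hU, hIg, hJg, -⟩ := nbhdFin hch (R := R - 3 * k.natAbs)
    (L := fun i j : ℤ => n + (K - k.natAbs) + (R - j.natAbs - i.natAbs) + 3) hvalk (fun i j hr => hSk i j hr) hIk hJk i j (by omega) h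
  obtain ⟨-, -, -, -, -, -, -, -, -, -, -, -, hparI, -⟩ :=
    Istep_spec hch hx hU (hregI_of_valid (Pc := Pc) (nb := nb) hIg)
  obtain ⟨-, -, -, -, -, -, -, -, -, -, -, -, hparJ, -⟩ :=
    Jstep_spec hch hx hU (hregJ_of_valid (Pc := Pc) (nb := nb) hJg)
  constructor
  · rw [hIk i j (by omega), h]; exact hparI
  · rw [hJk i j (by omega), h]; exact hparJ

/-- **STAR and LINK at every frame of the finite development** (graded `star_at`). [folklore] -/
theorem star_atFin {n K R : ℕ} {g₀ : ZFrame} (h₀ : IsFrame (Pc g₀.pt) g₀.t₁ g₀.t₂ g₀.U)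
    (h₀S : g₀.pt ∈ S (n + K + 4 + R)) (h₀p : frameParity g₀.t₁ g₀.t₂ g₀.U = 1)
    (h₀A : (∀ m, ∀ z ∈ S m, Pc z = fcc3Int) ∨ Pc g₀.pt = hcpInt) (hKR : 3 * K ≤ R)
    (k i j : ℤ) (hk : k.natAbs + 1 ≤ K) (hij : j.natAbs + i.natAbs + 3 * (k.natAbs + 1) + 4 ≤ R) {x : (EuclideanSpace ℝ (Fin 3))} {t₁ t₂ : Fin 3 → ℤ}
    {U : Finset (Fin 3 → ℤ)} (h : frameAt Pc nb g₀ k i j = ⟨x, t₁, t₂, U⟩) {σm σp : ℤ}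
    (hσp : frameParity t₁ t₂ U = σp) (hσm : lowerParity t₁ t₂ (lowerCap (Pc x) t₁ t₂ U) = σm) :
    Set.BijOn (fun y : ℤ × ℤ × ℤ => (frameAt Pc nb g₀ (k + y.1) (i - y.2.1) (j - y.2.2)).pt)
      (↑(linkOffsets σm σp) : Set (ℤ × ℤ × ℤ)) {z | B x z} ∧
    ∀ y ∈ linkOffsets σm σp, ∀ y' ∈ linkOffsets σm σp,
      ((B (frameAt Pc nb g₀ (k + y.1) (i - y.2.1) (j - y.2.2)).pt (frameAt Pc nb g₀ (k + y'.1) (i - y'.2.1) (j - y'.2.2)).pt) ↔ linkAdj σm σp y y') := by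
  obtain ⟨hvalk, hSk, -, -⟩ := planeAtFin hch h₀ h₀S h₀p h₀A hKR k (by omega)
  have hx : x ∈ S (n + (K - k.natAbs) + (R - j.natAbs - i.natAbs) + 4) := by
    have := hSk i j (by omega); rw [h] at this; exact this
  have hU : IsFrame (Pc x) t₁ t₂ U := by have := hvalk i j (by omega); rw [h] at this; exact this
  have hPx := pattern_cases hch hx
  obtain ⟨e1, e2, e3, e4, e5, e6, eU, eUp, eUm, eD, eDp, eDm⟩ := sitesFin hch h₀ h₀S h₀p h₀A hKR k i j hk hij h
  -- the label map and the site identities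
  set c := apexOf t₁ t₂ U with hc
  set d := apexOf t₁ t₂ (lowerCap (Pc x) t₁ t₂ U) with hd
  have hΦ : ∀ y ∈ linkOffsets σm σp, (frameAt Pc nb g₀ (k + y.1) (i - y.2.1) (j - y.2.2)).pt =
      nb x ((if y.1 = 1 then c else if y.1 = -1 then d else 0) - y.2.1 • t₁ - y.2.2 • t₂) := by
    intro y hy
    simp only [linkOffsets, Finset.mem_union, Finset.mem_image] at hy
    rcases hy with (⟨PQ, hPQ, rfl⟩ | ⟨PQ, hPQ, rfl⟩) | ⟨PQ, hPQ, rfl⟩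
    · simp only [sixOffsets, Finset.mem_insert, Finset.mem_singleton] at hPQ
      rcases hPQ with rfl | rfl | rfl | rfl | rfl | rfl
      · norm_num; exact e2
      · norm_num; exact e1
      · norm_num; exact e4
      · norm_num; exact e3
      · norm_num; rw [e5]; congr 1; abel
      · norm_num; rw [e6]
    · -- upper layer: offsets `threeOffsets (−σp)`
      rcases frameParity_eq_or t₁ t₂ U with hp | hp <;> rw [← hσp, hp] at hPQ
      · obtain ⟨f1, f2⟩ := eUp hp
        simp only [threeOffsets, Finset.mem_insert, Finset.mem_singleton, show ¬((-1 : ℤ) = 1) by decide,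
          if_false] at hPQ
        rcases hPQ with rfl | rfl | rfl
        · norm_num; exact eU
        · norm_num; rw [f1]
        · norm_num; rw [f2]
      · obtain ⟨f1, f2⟩ := eUm hp
        simp only [threeOffsets, Finset.mem_insert, Finset.mem_singleton, neg_neg, if_true] at hPQ
        rcases hPQ with rfl | rfl | rfl
        · norm_num; exact eU
        · norm_num; rw [f1]
        · norm_num; rw [f2]
    · -- lower layer: offsets `threeOffsets σm`
      rcases lowerParity_eq_or t₁ t₂ (lowerCap (Pc x) t₁ t₂ U) with hp | hp <;> rw [← hσm, hp] at hPQ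
      · obtain ⟨f1, f2⟩ := eDp hp
        simp only [threeOffsets, Finset.mem_insert, Finset.mem_singleton, if_true] at hPQ
        rcases hPQ with rfl | rfl | rfl
        · norm_num; rw [show k + -1 = k - 1 by ring]; exact eD
        · norm_num; rw [show k + -1 = k - 1 by ring]; exact f1
        · norm_num; rw [show k + -1 = k - 1 by ring]; exact f2
      · obtain ⟨f1, f2⟩ := eDm hp
        simp only [threeOffsets, Finset.mem_insert, Finset.mem_singleton, show ¬((-1 : ℤ) = 1) by decide,
          if_false] at hPQ
        rcases hPQ with rfl | rfl | rfl
        · norm_num; rw [show k + -1 = k - 1 by ring]; exact eD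
        · norm_num; rw [show k + -1 = k - 1 by ring]; exact f1
        · norm_num; rw [show k + -1 = k - 1 by ring]; exact f2
  -- the table for the four letter patterns
  have hcardP : (Pc x).card = 12 := by
    rcases hPx with hP | hP <;> rw [hP] <;> decide
  rcases hPx with hP | hP
  · rcases frameParity_eq_or t₁ t₂ U with hp | hp
    · obtain ⟨hlp, hdd, himg, hrows⟩ := table_fcc_p hch hx hU hP hp
      have hσm' : σm = 1 := by rw [← hσm, hlp]
      have hσp' : σp = 1 := by rw [← hσp, hp]
      subst hσm' hσp'
      rw [← hd, ← hc] at hdd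
      rw [← hc, ← hdd] at himg hrows
      exact star_core hch hx _ himg hrows (card_linkOffsets 1 (by simp) 1 (by simp)) hcardP _ hΦ
    · obtain ⟨hlp, hdd, himg, hrows⟩ := table_fcc_m hch hx hU hP hp
      have hσm' : σm = -1 := by rw [← hσm, hlp]
      have hσp' : σp = -1 := by rw [← hσp, hp]
      subst hσm' hσp'
      rw [← hd, ← hc] at hdd
      rw [← hc, ← hdd] at himg hrows
      exact star_core hch hx _ himg hrows (card_linkOffsets (-1) (by simp) (-1) (by simp)) hcardP _ hΦ
  · rcases frameParity_eq_or t₁ t₂ U with hp | hp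
    · obtain ⟨hlp, hdd, himg, hrows⟩ := table_hcp_p hch hx hU hP hp
      have hσm' : σm = -1 := by rw [← hσm, hlp]
      have hσp' : σp = 1 := by rw [← hσp, hp]
      subst hσm' hσp'
      rw [← hd, ← hc] at hdd
      rw [← hc, ← hdd] at himg hrows
      exact star_core hch hx _ himg hrows (card_linkOffsets (-1) (by simp) 1 (by simp)) hcardP _ hΦ
    · obtain ⟨hlp, hdd, himg, hrows⟩ := table_hcp_m hch hx hU hP hp
      have hσm' : σm = 1 := by rw [← hσm, hlp]
      have hσp' : σp = -1 := by rw [← hσp, hp]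
      subst hσm' hσp'
      rw [← hd, ← hc] at hdd
      rw [← hc, ← hdd] at himg hrows
      exact star_core hch hx _ himg hrows (card_linkOffsets 1 (by simp) (-1) (by simp)) hcardP _ hΦ

/-! ## Registered anchor (closed form) -/

omit hch in
/-- **Closed form of `par_IJFin`** (the registered anchor of this file): the section data
`S, B, Pc, nb` and the standing hypothesis written out (two hypotheses regrouped). [folklore] -/
theorem par_IJFin_graded :
    ∀ {S : ℕ → Set (EuclideanSpace ℝ (Fin 3))} {B : EuclideanSpace ℝ (Fin 3) → EuclideanSpace ℝ
    (Fin 3) → Prop} {Pc : EuclideanSpace ℝ (Fin 3) → Finset (Fin 3 → ℤ)} {nb : EuclideanSpace ℝ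
    (Fin 3) → (Fin 3 → ℤ) → EuclideanSpace ℝ (Fin 3)}, ((∀ n : ℕ, ∀ z ∈ S n, (Pc z =
    Summit.AtomisticToContinuum.Crystallization.Theorems.PalmUnimodularRigidityShellsToBarlowChart.fcc3Int
    ∨ Pc z = Literature.Geometry.DiscreteGeometry.hcpInt) ∧ Set.BijOn (nb z) (↑(Pc z) : Set (Fin
    3 → ℤ)) {y | B z y} ∧ ∀ t ∈ Pc z, ∀ t' ∈ Pc z, (B (nb z t) (nb z t') ↔
    Literature.Geometry.DiscreteGeometry.sqNormInt (t - t') = 18)) ∧ (∀ n : ℕ, ∀ z ∈ S (n + 1),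
    ∀ y, B z y → y ∈ S n) ∧ (∀ n m : ℕ, ∀ x ∈ S n, ∀ y ∈ S m, B x y → ∀ (z z' : EuclideanSpace ℝ
    (Fin 3)) (t t' u u' : Fin 3 → ℤ), (t = 0 ∧ z = x ∨ t ∈ Pc x ∧ z = nb x t) → (t' = 0 ∧ z' = x
    ∨ t' ∈ Pc x ∧ z' = nb x t') → (u = 0 ∧ z = y ∨ u ∈ Pc y ∧ z = nb y u) → (u' = 0 ∧ z' = y ∨
    u' ∈ Pc y ∧ z' = nb y u') → Literature.Geometry.DiscreteGeometry.sqNormInt (u - u') =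
    Literature.Geometry.DiscreteGeometry.sqNormInt (t - t')) ∧ (∀ x y, B x y → B y x)) → ∀ {n K
    R : ℕ} {g₀ :
    Summit.AtomisticToContinuum.Crystallization.Theorems.PalmUnimodularRigidityShellsToBarlowChart.ZFrame}
    (k i j : ℤ), g₀.pt ∈ S (n + K + 4 + R) →
    Summit.AtomisticToContinuum.Crystallization.Theorems.PalmUnimodularRigidityShellsToBarlowChart.IsFrame
    (Pc g₀.pt) g₀.t₁ g₀.t₂ g₀.U →
    Summit.AtomisticToContinuum.Crystallization.Theorems.PalmUnimodularRigidityShellsToBarlowChart.frameParity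
    g₀.t₁ g₀.t₂ g₀.U = 1 → (∀ m, ∀ z ∈ S m, Pc z =
    Summit.AtomisticToContinuum.Crystallization.Theorems.PalmUnimodularRigidityShellsToBarlowChart.fcc3Int)
    ∨ Pc g₀.pt = Literature.Geometry.DiscreteGeometry.hcpInt → 3 * K ≤ R → k.natAbs ≤ K →
    j.natAbs + i.natAbs + 3 * k.natAbs + 4 ≤ R →
    Summit.AtomisticToContinuum.Crystallization.Theorems.PalmUnimodularRigidityShellsToBarlowChart.frameParity
    (frameAt Pc nb g₀ k (i + 1) j).t₁ (frameAt Pc nb g₀ k (i + 1) j).t₂ (frameAt Pc nb g₀ k (i +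
    1) j).U =
    Summit.AtomisticToContinuum.Crystallization.Theorems.PalmUnimodularRigidityShellsToBarlowChart.frameParity
    (frameAt Pc nb g₀ k i j).t₁ (frameAt Pc nb g₀ k i j).t₂ (frameAt Pc nb g₀ k i j).U ∧
    Summit.AtomisticToContinuum.Crystallization.Theorems.PalmUnimodularRigidityShellsToBarlowChart.frameParity
    (frameAt Pc nb g₀ k i (j + 1)).t₁ (frameAt Pc nb g₀ k i (j + 1)).t₂ (frameAt Pc nb g₀ k i (j
    + 1)).U =
    Summit.AtomisticToContinuum.Crystallization.Theorems.PalmUnimodularRigidityShellsToBarlowChart.frameParity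
    (frameAt Pc nb g₀ k i j).t₁ (frameAt Pc nb g₀ k i j).t₂ (frameAt Pc nb g₀ k i j).U := by
  intro S B Pc nb hch n K R g₀ k i j h₀S h₀ h₀p h₀A hKR hk hij
  exact par_IJFin hch h₀ h₀S h₀p h₀A hKR k i j hk hij

end Summit.AtomisticToContinuum.Crystallization.Theorems.SquareWellLayerCakeGapTwelveToBarlow

end
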